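import Literature.Analysis.ODE.OneSidedLipschitzGronwall
import HarnessLib

/-!
# `C⁰`-convergence of Galerkin flows under a uniform one-sided Lipschitz bound

Topic `Literature/Analysis/ODE`.  The abstract content of [WilczakZgliczynski2025, §4 Thm. 11]
(a generalisation of Zgliczyński's `C⁰`-convergence theorem for dissipative PDEs, loc. cit.
"Theorem 13 in [Z]"): the local flows `φⁿ` of the GALERKIN PROJECTIONS `u' = P_n F (u)` of an
infinite-dimensional system `u' = F (u)` converge, uniformly on `Z × [0, T]`, to a semiflow `φ`
of the full system, which is the UNIQUE solution within the set `W` of a priori bounds and is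
`e^{l t}`-Lipschitz in the initial condition — provided (S) `W` is compact with `P_n W ⊆ W`,
(C1) `F` is continuous on `W`, (C2) the LOGARITHMIC NORMS of the Galerkin fields are bounded
above by one constant `l ∈ ℝ` UNIFORMLY IN `n`, and the Galerkin solutions started in `P_n Z`
stay in `W` on `[0, T]` (the a priori bounds a rigorous integrator establishes).  This is the
theorem that turns validated numerics for the Galerkin ODEs (self-consistent bounds, cf.
`Literature.Analysis.ODE.DissipativeTailIsolation`) into statements about the PDE.  The
analytic engine is the fundamental lemma with a one-sided Lipschitz constant of any sign,
`Literature.Analysis.ODE.dist_le_of_approx_trajectories_of_oneSidedLipschitz`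
([HairerNorsettWanner1993, §I.10 Thm. 10.6]; [WilczakZgliczynski2025, Lemma 10]).

## The abstract setting

`GalerkinConvergenceSetting P F W Z T l u` (a `Prop`-valued structure) records, on a real normed
space `E`: projections `P n : E →L[ℝ] E` with `‖P n‖ ≤ C`, `P n w → w` for every `w`
([WilczakZgliczynski2025, §2 Def. 1 (4) and Lemma 1] for a good sequence space), nested
(`P n ∘ P k = P n` for `n ≤ k`: a Galerkin filtration) and mapping `W` into `W` (condition S1,
after re-indexing so that `M = 0`); `W` compact (S2), `Z ⊆ W`; `F` continuous on `W` (C1); the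
Galerkin field `y ↦ P n (F y)` ONE-SIDED LIPSCHITZ with constant `l` on `P n '' W` for every `n`
(C2 — for the max norm this is the Gershgorin row condition on an enclosure of `DFⁿ`,
`Literature.Analysis.ODE.oneSidedLipschitzOnWith_pi_of_rowSum_le`; for a Hilbert norm
`Literature.Analysis.ODE.oneSidedLipschitzOnWith_of_inner_le`); and, for every level `n` and
`x ∈ Z`, a Galerkin solution `u n x : [0, T] → W ∩ range (P n)`, continuous on `[0, T]`,
differentiable on `(0, T)` with `(u n x)' = P n (F (u n x))`, `u n x 0 = P n x` (the a priori
bounds [WilczakZgliczynski2025, eq. (apriori-bnds)]; `0 ≤ T`).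

## Main statements

* `tendstoUniformlyOn_of_isCompact_of_opNorm_le`: uniformly bounded linear maps converging
  pointwise converge uniformly on compact sets — the "uniform tails" `sup_W ‖(I - P_n) w‖ → 0`
  of [WilczakZgliczynski2025, §2 Lemma 2].
* `dist_le_of_approx_trajectories_of_oneSidedLipschitz_of_hasDerivAt`: the fundamental lemma
  of `OneSidedLipschitzGronwall.lean` for approximate solutions differentiable on the open
  interval `(a, b)` and continuous on `[a, b]`.
* `GalerkinConvergenceSetting.norm_sub_proj_le`: the key estimate
  `‖uⁿ (t) - P_n uᵏ (t)‖ ≤ e^{l t} ‖P_n x - P_n y‖ + δ_n κ_l (t)` for `n ≤ k`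
  ([WilczakZgliczynski2025, eq. (xn-Pn)]), where `δ_n` bounds the Galerkin defect
  `‖P_n F (w) - P_n F (P_n w)‖` on `W`; `eventually_defect_le`: `δ_n → 0`;
  `norm_sub_le_exp`: `‖uⁿ_x (t) - uⁿ_y (t)‖ ≤ e^{l t} ‖P_n x - P_n y‖`.
* `GalerkinConvergenceSetting.uniformCauchySeqOn`, `exists_tendstoUniformlyOn` (Banach space):
  the Galerkin solutions are uniformly Cauchy on `Z × [0, T]`, hence converge uniformly to some
  `φ` ([WilczakZgliczynski2025, Thm. 11 (1)]).
* For ANY uniform limit `φ` on `Z × [0, T]`: `limit_init` (`φ x 0 = x`), `limit_mem`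
  (`φ x t ∈ W`), `limit_continuousOn`, `limit_hasDerivAt` (EXISTENCE: `(φ x)' = F (φ x)` on
  `(0, T)`, via `tendstoUniformlyOn_field`: `P_n F (uⁿ_x) → F (φ x)` uniformly, and Mathlib's
  `hasDerivAt_of_tendstoUniformlyOn`), `limit_unique` (UNIQUENESS WITHIN `W`: any solution of
  `w' = F (w)` on `(0, T)`, continuous on `[0, T]`, with `w 0 = x ∈ Z` and `w t ∈ W`, equals
  `φ x` — it is itself the limit of the Galerkin solutions), `limit_lipschitz`
  (`‖φ x t - φ y t‖ ≤ e^{l t} ‖x - y‖`) — [WilczakZgliczynski2025, Thm. 11 (2), (3)].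
* `GalerkinConvergenceSetting.exists_limit`: (1)–(3) packaged.

## Proof sketch

Exactly the proof of [WilczakZgliczynski2025, Thm. 11]: `y = P_n uᵏ` solves the level-`n`
equation up to the defect `P_n F (uᵏ) - P_n F (P_n uᵏ)` (using `P_n P_k = P_n`), so the
one-sided fundamental lemma on `P_n '' W` gives (xn-Pn); `δ_n → 0` by uniform continuity of `F`
on the compact `W` and the uniform tails; with `‖(I - P_n) uᵏ‖ ≤ sup_W ‖(I - P_n) w‖ → 0` the
family is uniformly Cauchy.  Existence: the derivatives `P_n F (uⁿ)` converge uniformly to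
`F (φ)` (uniform continuity of `F` on `W`, uniform tails on the compact `F (W)`), so the limit is
differentiable with that derivative.  Uniqueness: `P_n w` is again a `δ_n`-solution of level
`n`, so `uⁿ → w`.  Lipschitz: pass to the limit in `‖uⁿ_x - uⁿ_y‖ ≤ e^{l t} ‖P_n x - P_n y‖`.

## References

* [WilczakZgliczynski2025] D. Wilczak, P. Zgliczyński, *Self-consistent bounds method for
  dissipative PDEs*, arXiv:2502.09760: §2 Def. 1, Lemmas 1–2; §3.2 Lemma 10; §4 Def. 4–6,
  Thm. 11 and its proof.
* [HairerNorsettWanner1993] E. Hairer, S. P. Nørsett, G. Wanner, *Solving Ordinary Differential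
  Equations I*, 2nd ed., §I.10 Thm. 10.6.
* Mathlib: `hasDerivAt_of_tendstoUniformlyOn`, `UniformCauchySeqOn`, `gronwallBound`.
-/

open Set Filter Topology Metric
open scoped NNReal

namespace Literature.Analysis.ODE

noncomputable section

variable {E : Type*} [NormedAddCommGroup E] [NormedSpace ℝ E]

/-! ## Uniform tails on compact sets -/

/-- Uniformly bounded linear maps converging pointwise converge uniformly on compact sets.
[cite: WilczakZgliczynski2025, §2 Lemma 1 (eq. remto0) and Lemma 2 (⇒)] -/
theorem tendstoUniformlyOn_of_isCompact_of_opNorm_le {P : ℕ → E →L[ℝ] E} {C : ℝ}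
    (hC : ∀ n, ‖P n‖ ≤ C) {K : Set E} (hK : IsCompact K)
    (hP : ∀ w ∈ K, Tendsto (fun n => P n w) atTop (𝓝 w)) :
    TendstoUniformlyOn (fun n w => P n w) id atTop K := by
  rw [Metric.tendstoUniformlyOn_iff]
  intro ε hε
  have hC0 : 0 ≤ C := (norm_nonneg _).trans (hC 0)
  set η := ε / (3 * (C + 1)) with hη
  have hη0 : 0 < η := by positivity
  obtain ⟨t, htK, htfin, hcover⟩ := hK.finite_cover_balls hη0
  have hev : ∀ᶠ n in atTop, ∀ c ∈ t, dist (P n c) c < ε / 3 := by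
    refine htfin.eventually_all.2 fun c hc => ?_
    exact Metric.tendsto_nhds.1 (hP c (htK hc)) (ε / 3) (by positivity)
  filter_upwards [hev] with n hn w hw
  obtain ⟨c, hc, hwc⟩ := Set.mem_iUnion₂.1 (hcover hw)
  have hwc' : ‖w - c‖ < η := by rw [← dist_eq_norm]; exact Metric.mem_ball.1 hwc
  have h1 : ‖P n (w - c)‖ ≤ C * η :=
    ((P n).le_opNorm _).trans (mul_le_mul (hC n) hwc'.le (norm_nonneg _) hC0)
  have h2 : ‖P n c - c‖ < ε / 3 := by rw [← dist_eq_norm]; exact hn c hc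
  have h3 : ‖c - w‖ < η := by rw [← dist_eq_norm, dist_comm, dist_eq_norm]; exact hwc'
  have hCη : (C + 1) * η = ε / 3 := by rw [hη]; field_simp
  calc dist (id w) (P n w) = ‖P n w - w‖ := by rw [dist_comm, dist_eq_norm]; rfl
    _ = ‖P n (w - c) + (P n c - c) + (c - w)‖ := by rw [map_sub]; congr 1; abel
    _ ≤ ‖P n (w - c)‖ + ‖P n c - c‖ + ‖c - w‖ := norm_add₃_le
    _ < C * η + ε / 3 + η := by linarith
    _ = 2 * (ε / 3) := by linear_combination hCη
    _ < ε := by linarith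

/-! ## The fundamental lemma for interior derivatives -/

/-- Joint continuity of `gronwallBound δ K ε x` in `(δ, x)`. [folklore] -/
private theorem continuous_gronwallBound_δx (K ε : ℝ) :
    Continuous fun p : ℝ × ℝ => gronwallBound p.1 K ε p.2 := by
  by_cases hK : K = 0
  · subst hK
    simp only [gronwallBound_K0]
    fun_prop
  · simp only [gronwallBound_of_K_ne_0 hK]
    fun_prop

/-- Monotonicity of `gronwallBound` in the initial distance. [folklore] -/
private theorem gronwallBound_mono_δ {δ δ' K ε x : ℝ} (h : δ ≤ δ') :
    gronwallBound δ K ε x ≤ gronwallBound δ' K ε x := by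
  by_cases hK : K = 0
  · subst hK
    simp only [gronwallBound_K0]
    linarith
  · simp only [gronwallBound_of_K_ne_0 hK]
    have := Real.exp_pos (K * x)
    nlinarith

/-- The fundamental lemma (`dist_le_of_approx_trajectories_of_oneSidedLipschitz`) for
approximate solutions that are continuous on `[a, b]` and differentiable on the OPEN interval
`(a, b)` (two-sided derivatives, as delivered by a `C¹` flow), the initial distance being taken
at `a`: same conclusion `dist (f t) (g t) ≤ gronwallBound δ l (εf + εg) (t - a)`.
[cite: HairerNorsettWanner1993, §I.10 Thm. 10.6]
[cite: WilczakZgliczynski2025, §3.2 Lemma 10] -/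
theorem dist_le_of_approx_trajectories_of_oneSidedLipschitz_of_hasDerivAt
    {v : ℝ → E → E} {s : ℝ → Set E} {l : ℝ} {f g f' g' : ℝ → E} {a b εf εg δ : ℝ}
    (hv : ∀ t ∈ Ioo a b, OneSidedLipschitzOnWith l (v t) (s t))
    (hf : ContinuousOn f (Icc a b))
    (hf' : ∀ t ∈ Ioo a b, HasDerivAt f (f' t) t)
    (f_bound : ∀ t ∈ Ioo a b, dist (f' t) (v t (f t)) ≤ εf)
    (hfs : ∀ t ∈ Ioo a b, f t ∈ s t)
    (hg : ContinuousOn g (Icc a b))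
    (hg' : ∀ t ∈ Ioo a b, HasDerivAt g (g' t) t)
    (g_bound : ∀ t ∈ Ioo a b, dist (g' t) (v t (g t)) ≤ εg)
    (hgs : ∀ t ∈ Ioo a b, g t ∈ s t)
    (ha : dist (f a) (g a) ≤ δ) :
    ∀ t ∈ Icc a b, dist (f t) (g t) ≤ gronwallBound δ l (εf + εg) (t - a) := by
  intro t ht
  rcases eq_or_lt_of_le ht.1 with rfl | hat
  · simpa [gronwallBound_x0] using ha
  have key : ∀ a' ∈ Ioo a t,
      dist (f t) (g t) ≤ gronwallBound (dist (f a') (g a')) l (εf + εg) (t - a') := by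
    intro a' ha'
    have hsub1 : Icc a' b ⊆ Icc a b := Icc_subset_Icc ha'.1.le le_rfl
    have hsub2 : Ico a' b ⊆ Ioo a b := fun x hx => ⟨ha'.1.trans_le hx.1, hx.2⟩
    exact dist_le_of_approx_trajectories_of_oneSidedLipschitz (a := a') (b := b)
      (fun x hx => hv x (hsub2 hx)) (hf.mono hsub1)
      (fun x hx => (hf' x (hsub2 hx)).hasDerivWithinAt)
      (fun x hx => f_bound x (hsub2 hx)) (fun x hx => hfs x (hsub2 hx))
      (hg.mono hsub1) (fun x hx => (hg' x (hsub2 hx)).hasDerivWithinAt)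
      (fun x hx => g_bound x (hsub2 hx)) (fun x hx => hgs x (hsub2 hx)) le_rfl t
      ⟨ha'.2.le, ht.2⟩
  have hab : a < b := hat.trans_le ht.2
  have hIcc : Icc a b ∈ 𝓝[>] a := mem_of_superset (Ioo_mem_nhdsGT hab) Ioo_subset_Icc_self
  have hfa : Tendsto f (𝓝[>] a) (𝓝 (f a)) :=
    (hf a ⟨le_rfl, hab.le⟩).mono_of_mem_nhdsWithin hIcc
  have hga : Tendsto g (𝓝[>] a) (𝓝 (g a)) :=
    (hg a ⟨le_rfl, hab.le⟩).mono_of_mem_nhdsWithin hIcc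
  have hd : Tendsto (fun a' => dist (f a') (g a')) (𝓝[>] a) (𝓝 (dist (f a) (g a))) :=
    hfa.dist hga
  have hx : Tendsto (fun a' : ℝ => t - a') (𝓝[>] a) (𝓝 (t - a)) :=
    ((continuous_const.sub continuous_id).tendsto a).mono_left nhdsWithin_le_nhds
  have hlim : Tendsto (fun a' => gronwallBound (dist (f a') (g a')) l (εf + εg) (t - a'))
      (𝓝[>] a) (𝓝 (gronwallBound (dist (f a) (g a)) l (εf + εg) (t - a))) :=
    ((continuous_gronwallBound_δx l (εf + εg)).tendsto (dist (f a) (g a), t - a)).comp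
      (hd.prodMk_nhds hx)
  have hle : dist (f t) (g t) ≤ gronwallBound (dist (f a) (g a)) l (εf + εg) (t - a) :=
    ge_of_tendsto hlim (by
      filter_upwards [Ioo_mem_nhdsGT hat] with a' ha' using key a' ha')
  exact hle.trans (gronwallBound_mono_δ ha)

/-! ## Bounds for `gronwallBound 0 l d` on `[0, T]` -/

/-- `gronwallBound 0 K d x = d * gronwallBound 0 K 1 x` (`= d κ_K (x)`). [folklore] -/
private theorem gronwallBound_zero_eq_mul (K d x : ℝ) :
    gronwallBound 0 K d x = d * gronwallBound 0 K 1 x := by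
  by_cases hK : K = 0
  · subst hK; simp only [gronwallBound_K0]; ring
  · simp only [gronwallBound_of_K_ne_0 hK]; ring

/-- `κ_K (t) = gronwallBound 0 K 1 t` is monotone in `t`. [folklore] -/
private theorem gronwallBound_zero_one_mono {K t T : ℝ} (htT : t ≤ T) :
    gronwallBound 0 K 1 t ≤ gronwallBound 0 K 1 T := by
  by_cases hK : K = 0
  · subst hK; simp only [gronwallBound_K0]; linarith
  · simp only [gronwallBound_of_K_ne_0 hK, zero_mul, zero_add, one_div]
    rcases lt_or_gt_of_ne hK with hK' | hK'
    · have : Real.exp (K * T) ≤ Real.exp (K * t) := Real.exp_le_exp.2 (by nlinarith)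
      have hi : K⁻¹ < 0 := inv_lt_zero.2 hK'
      nlinarith
    · have : Real.exp (K * t) ≤ Real.exp (K * T) := Real.exp_le_exp.2 (by nlinarith)
      have hi : 0 < K⁻¹ := inv_pos.2 hK'
      nlinarith

/-- `0 ≤ κ_K (t)` for `t ≥ 0`. [folklore] -/
private theorem gronwallBound_zero_one_nonneg {K t : ℝ} (ht : 0 ≤ t) :
    0 ≤ gronwallBound 0 K 1 t := by
  have := gronwallBound_zero_one_mono (K := K) ht
  rwa [gronwallBound_x0] at this

/-! ## The abstract Galerkin setting of [WilczakZgliczynski2025, Thm. 11] -/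

/-- The hypotheses of the `C⁰`-convergence theorem for Galerkin projections, in abstract form.
[cite: WilczakZgliczynski2025, §4 Def. 4–6 (conditions S, C1, C2), eq. (apriori-bnds) and §2 Def. 1, Lemma 1] -/
structure GalerkinConvergenceSetting (P : ℕ → E →L[ℝ] E) (F : E → E) (W Z : Set E)
    (T l : ℝ) (u : ℕ → E → ℝ → E) : Prop where
  nonneg : 0 ≤ T
  isCompact : IsCompact W
  subset : Z ⊆ W
  opNorm_le : ∃ C, ∀ n, ‖P n‖ ≤ C
  tendsto_proj : ∀ w, Tendsto (fun n => P n w) atTop (𝓝 w)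
  proj_comp : ∀ n k, n ≤ k → ∀ w, P n (P k w) = P n w
  mapsTo : ∀ n, MapsTo (P n) W W
  continuousOn : ContinuousOn F W
  oneSided : ∀ n, OneSidedLipschitzOnWith l (fun y => P n (F y)) (P n '' W)
  sol_continuousOn : ∀ n, ∀ x ∈ Z, ContinuousOn (u n x) (Icc 0 T)
  sol_init : ∀ n, ∀ x ∈ Z, u n x 0 = P n x
  sol_hasDerivAt : ∀ n, ∀ x ∈ Z, ∀ t ∈ Ioo 0 T, HasDerivAt (u n x) (P n (F (u n x t))) t
  sol_mem : ∀ n, ∀ x ∈ Z, ∀ t ∈ Icc 0 T, u n x t ∈ W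
  sol_proj : ∀ n, ∀ x ∈ Z, ∀ t ∈ Icc 0 T, P n (u n x t) = u n x t

namespace GalerkinConvergenceSetting

variable {P : ℕ → E →L[ℝ] E} {F : E → E} {W Z : Set E} {T l : ℝ} {u : ℕ → E → ℝ → E}

/-- The key estimate: level `n` versus the projection of level `k ≥ n`.
[cite: WilczakZgliczynski2025, proof of Thm. 11, eq. (xn-Pn)] -/
theorem norm_sub_proj_le (h : GalerkinConvergenceSetting P F W Z T l u) {n k : ℕ} (hnk : n ≤ k)
    {d : ℝ} (hd : ∀ w ∈ W, ‖P n (F w) - P n (F (P n w))‖ ≤ d)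
    {x y : E} (hx : x ∈ Z) (hy : y ∈ Z) {t : ℝ} (ht : t ∈ Icc 0 T) :
    ‖u n x t - P n (u k y t)‖ ≤ gronwallBound ‖P n x - P n y‖ l d t := by
  have key := dist_le_of_approx_trajectories_of_oneSidedLipschitz_of_hasDerivAt
    (v := fun _ y => P n (F y)) (s := fun _ => P n '' W) (l := l) (f := u n x)
    (g := fun t => P n (u k y t)) (f' := fun t => P n (F (u n x t)))
    (g' := fun t => P n (P k (F (u k y t)))) (a := 0) (b := T) (εf := 0) (εg := d)
    (δ := ‖P n x - P n y‖)
    (fun _ _ => h.oneSided n) (h.sol_continuousOn n x hx)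
    (fun t ht => h.sol_hasDerivAt n x hx t ht) (fun t _ => (dist_self _).le)
    (fun t ht => ⟨u n x t, h.sol_mem n x hx t (Ioo_subset_Icc_self ht),
      h.sol_proj n x hx t (Ioo_subset_Icc_self ht)⟩)
    ((P n).continuous.comp_continuousOn (h.sol_continuousOn k y hy))
    (fun t ht => (P n).hasFDerivAt.comp_hasDerivAt t (h.sol_hasDerivAt k y hy t ht))
    (fun t ht => by
      rw [h.proj_comp n k hnk, dist_eq_norm]
      exact hd _ (h.sol_mem k y hy t (Ioo_subset_Icc_self ht)))
    (fun t ht => ⟨u k y t, h.sol_mem k y hy t (Ioo_subset_Icc_self ht), rfl⟩)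
    (by rw [h.sol_init n x hx, h.sol_init k y hy, h.proj_comp n k hnk, dist_eq_norm])
    t ht
  simpa [dist_eq_norm] using key

/-- Two Galerkin solutions of the SAME level: `‖u n x t - u n y t‖ ≤ e^{l t} ‖P n x - P n y‖`.
[cite: WilczakZgliczynski2025, proof of Thm. 11 ("Lipschitz constant on W")] -/
theorem norm_sub_le_exp (h : GalerkinConvergenceSetting P F W Z T l u) (n : ℕ)
    {x y : E} (hx : x ∈ Z) (hy : y ∈ Z) {t : ℝ} (ht : t ∈ Icc 0 T) :
    ‖u n x t - u n y t‖ ≤ Real.exp (l * t) * ‖P n x - P n y‖ := by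
  have key := dist_le_of_approx_trajectories_of_oneSidedLipschitz_of_hasDerivAt
    (v := fun _ y => P n (F y)) (s := fun _ => P n '' W) (l := l) (f := u n x)
    (g := u n y) (f' := fun t => P n (F (u n x t))) (g' := fun t => P n (F (u n y t)))
    (a := 0) (b := T) (εf := 0) (εg := 0) (δ := ‖P n x - P n y‖)
    (fun _ _ => h.oneSided n) (h.sol_continuousOn n x hx)
    (fun t ht => h.sol_hasDerivAt n x hx t ht) (fun t _ => (dist_self _).le)
    (fun t ht => ⟨u n x t, h.sol_mem n x hx t (Ioo_subset_Icc_self ht),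
      h.sol_proj n x hx t (Ioo_subset_Icc_self ht)⟩)
    (h.sol_continuousOn n y hy)
    (fun t ht => h.sol_hasDerivAt n y hy t ht) (fun t _ => (dist_self _).le)
    (fun t ht => ⟨u n y t, h.sol_mem n y hy t (Ioo_subset_Icc_self ht),
      h.sol_proj n y hy t (Ioo_subset_Icc_self ht)⟩)
    (by rw [h.sol_init n x hx, h.sol_init n y hy, dist_eq_norm])
    t ht
  rw [add_zero, gronwallBound_ε0, sub_zero, dist_eq_norm] at key
  linarith [key]

/-- The Galerkin defect `δ_n = sup_{w ∈ W} ‖P_n F (w) - P_n F (P_n w)‖` tends to `0`.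
[cite: WilczakZgliczynski2025, proof of Thm. 11 ("Obviously δ_n → 0")] -/
theorem eventually_defect_le (h : GalerkinConvergenceSetting P F W Z T l u) {ε : ℝ}
    (hε : 0 < ε) : ∀ᶠ n in atTop, ∀ w ∈ W, ‖P n (F w) - P n (F (P n w))‖ ≤ ε := by
  obtain ⟨C, hC⟩ := h.opNorm_le
  have hC0 : 0 ≤ C := (norm_nonneg _).trans (hC 0)
  have hUC := h.isCompact.uniformContinuousOn_of_continuous h.continuousOn
  obtain ⟨η, hη, hηF⟩ := Metric.uniformContinuousOn_iff.1 hUC (ε / (C + 1)) (by positivity)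
  have htail := Metric.tendstoUniformlyOn_iff.1
    (tendstoUniformlyOn_of_isCompact_of_opNorm_le hC h.isCompact (fun w _ => h.tendsto_proj w))
    η hη
  filter_upwards [htail] with n hn w hw
  have hPw : P n w ∈ W := h.mapsTo n hw
  have h1 : dist (F w) (F (P n w)) < ε / (C + 1) := hηF w hw (P n w) hPw (hn w hw)
  rw [dist_eq_norm] at h1
  calc ‖P n (F w) - P n (F (P n w))‖ = ‖P n (F w - F (P n w))‖ := by rw [map_sub]
    _ ≤ C * ‖F w - F (P n w)‖ := ((P n).le_opNorm _).trans (by gcongr; exact hC n)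
    _ ≤ C * (ε / (C + 1)) := by gcongr
    _ ≤ ε := by
      rw [mul_div_assoc']
      exact (div_le_iff₀ (by positivity)).2 (by nlinarith)

/-- The Galerkin solutions `û^n = u n` form a uniformly Cauchy sequence on `Z × [0, T]`.
[cite: WilczakZgliczynski2025, Thm. 11 (1), proof ("Convergence")] -/
theorem uniformCauchySeqOn (h : GalerkinConvergenceSetting P F W Z T l u) :
    UniformCauchySeqOn (fun n (p : E × ℝ) => u n p.1 p.2) atTop (Z ×ˢ Icc 0 T) := by
  obtain ⟨C, hC⟩ := h.opNorm_le
  rw [Metric.uniformCauchySeqOn_iff]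
  intro ε hε
  set B := gronwallBound 0 l 1 T with hB
  have hB0 : 0 ≤ B := gronwallBound_zero_one_nonneg h.nonneg
  obtain ⟨N₁, hN₁⟩ := eventually_atTop.1 (h.eventually_defect_le (ε := ε / (3 * (B + 1)))
    (by positivity))
  obtain ⟨N₂, hN₂⟩ := eventually_atTop.1 (Metric.tendstoUniformlyOn_iff.1
    (tendstoUniformlyOn_of_isCompact_of_opNorm_le hC h.isCompact (fun w _ => h.tendsto_proj w))
    (ε / 3) (by positivity))
  -- one-sided comparison for `n ≤ k`
  have main : ∀ n k, max N₁ N₂ ≤ n → n ≤ k → ∀ p ∈ Z ×ˢ Icc 0 T,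
      dist (u n p.1 p.2) (u k p.1 p.2) < ε := by
    rintro n k hn hnk ⟨x, t⟩ ⟨hx, ht⟩
    have hn₁ : N₁ ≤ n := (le_max_left _ _).trans hn
    have hn₂ : N₂ ≤ n := (le_max_right _ _).trans hn
    have e1 : ‖u n x t - P n (u k x t)‖ ≤ ε / (3 * (B + 1)) * B := by
      have := h.norm_sub_proj_le hnk (hN₁ n hn₁) hx hx ht
      rw [sub_self, norm_zero, gronwallBound_zero_eq_mul] at this
      exact this.trans (mul_le_mul_of_nonneg_left (gronwallBound_zero_one_mono ht.2)
        (by positivity))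
    have e2 : ‖P n (u k x t) - u k x t‖ < ε / 3 := by
      have := hN₂ n hn₂ (u k x t) (h.sol_mem k x hx t ht)
      rwa [dist_comm, dist_eq_norm] at this
    have e3 : ε / (3 * (B + 1)) * B ≤ ε / 3 := by
      rw [div_mul_eq_mul_div, div_le_div_iff₀ (by positivity) (by positivity)]
      nlinarith
    calc dist (u n x t) (u k x t) = ‖(u n x t - P n (u k x t)) + (P n (u k x t) - u k x t)‖ := by
          rw [dist_eq_norm]; congr 1; abel
      _ ≤ ‖u n x t - P n (u k x t)‖ + ‖P n (u k x t) - u k x t‖ := norm_add_le _ _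
      _ < ε / 3 + ε / 3 := by linarith
      _ ≤ ε := by linarith
  refine ⟨max N₁ N₂, fun m hm n hn p hp => ?_⟩
  rcases le_total m n with hmn | hnm
  · exact main m n hm hmn p hp
  · rw [dist_comm]; exact main n m hn hnm p hp

/-- Existence of the uniform limit `φ` of the Galerkin solutions on `Z × [0, T]`.
[cite: WilczakZgliczynski2025, Thm. 11 (1)] -/
theorem exists_tendstoUniformlyOn [CompleteSpace E] (h : GalerkinConvergenceSetting P F W Z T l u) :
    ∃ φ : E → ℝ → E, TendstoUniformlyOn (fun n (p : E × ℝ) => u n p.1 p.2)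
      (fun p => φ p.1 p.2) atTop (Z ×ˢ Icc 0 T) := by
  have hU := h.uniformCauchySeqOn
  refine ⟨fun x t => limUnder atTop (fun n => u n x t), hU.tendstoUniformlyOn_of_tendsto ?_⟩
  rintro ⟨x, t⟩ hp
  exact tendsto_nhds_limUnder (cauchySeq_tendsto_of_complete (hU.cauchySeq hp))

section Limit

variable {φ : E → ℝ → E}

omit [NormedSpace ℝ E] in
/-- Slices of the uniform convergence at a fixed initial condition. [folklore] -/
private theorem tendstoUniformlyOn_slice
    (hφ : TendstoUniformlyOn (fun n (p : E × ℝ) => u n p.1 p.2) (fun p => φ p.1 p.2) atTop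
      (Z ×ˢ Icc 0 T)) {x : E} (hx : x ∈ Z) :
    TendstoUniformlyOn (fun n t => u n x t) (φ x) atTop (Icc 0 T) :=
  (hφ.comp fun t : ℝ => (x, t)).mono fun t ht => (⟨hx, ht⟩ : (x, t) ∈ Z ×ˢ Icc 0 T)

/-- The limit starts at `x`: `φ x 0 = x`. [cite: WilczakZgliczynski2025, Thm. 11 (2)] -/
theorem limit_init (h : GalerkinConvergenceSetting P F W Z T l u)
    (hφ : TendstoUniformlyOn (fun n (p : E × ℝ) => u n p.1 p.2) (fun p => φ p.1 p.2) atTop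
      (Z ×ˢ Icc 0 T)) {x : E} (hx : x ∈ Z) : φ x 0 = x := by
  have h1 : Tendsto (fun n => u n x 0) atTop (𝓝 (φ x 0)) :=
    (tendstoUniformlyOn_slice hφ hx).tendsto_at ⟨le_rfl, h.nonneg⟩
  have h2 : Tendsto (fun n => u n x 0) atTop (𝓝 x) := by
    have : (fun n => u n x 0) = fun n => P n x := funext fun n => h.sol_init n x hx
    rw [this]; exact h.tendsto_proj x
  exact tendsto_nhds_unique h1 h2

/-- The limit stays in `W`. [cite: WilczakZgliczynski2025, Thm. 11 (φ : [0,T] × Z → W)] -/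
theorem limit_mem (h : GalerkinConvergenceSetting P F W Z T l u)
    (hφ : TendstoUniformlyOn (fun n (p : E × ℝ) => u n p.1 p.2) (fun p => φ p.1 p.2) atTop
      (Z ×ˢ Icc 0 T)) {x : E} (hx : x ∈ Z) {t : ℝ} (ht : t ∈ Icc 0 T) : φ x t ∈ W :=
  h.isCompact.isClosed.mem_of_tendsto ((tendstoUniformlyOn_slice hφ hx).tendsto_at ht)
    (Eventually.of_forall fun n => h.sol_mem n x hx t ht)

/-- The limit is continuous in time on `[0, T]`. [cite: WilczakZgliczynski2025, Thm. 11 (φ continuous)] -/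
theorem limit_continuousOn (h : GalerkinConvergenceSetting P F W Z T l u)
    (hφ : TendstoUniformlyOn (fun n (p : E × ℝ) => u n p.1 p.2) (fun p => φ p.1 p.2) atTop
      (Z ×ˢ Icc 0 T)) {x : E} (hx : x ∈ Z) : ContinuousOn (φ x) (Icc 0 T) :=
  (tendstoUniformlyOn_slice hφ hx).continuousOn
    (Eventually.of_forall fun n => h.sol_continuousOn n x hx).frequently

/-- The Galerkin vector fields along the Galerkin solutions converge uniformly to `F ∘ φ x`.
[cite: WilczakZgliczynski2025, proof of Thm. 11 ("Existence": uniform continuity of F on W)] -/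
theorem tendstoUniformlyOn_field (h : GalerkinConvergenceSetting P F W Z T l u)
    (hφ : TendstoUniformlyOn (fun n (p : E × ℝ) => u n p.1 p.2) (fun p => φ p.1 p.2) atTop
      (Z ×ˢ Icc 0 T)) {x : E} (hx : x ∈ Z) :
    TendstoUniformlyOn (fun n t => P n (F (u n x t))) (fun t => F (φ x t)) atTop (Icc 0 T) := by
  obtain ⟨C, hC⟩ := h.opNorm_le
  have hC0 : 0 ≤ C := (norm_nonneg _).trans (hC 0)
  rw [Metric.tendstoUniformlyOn_iff]
  intro ε hε
  have hUC := h.isCompact.uniformContinuousOn_of_continuous h.continuousOn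
  obtain ⟨η, hη, hηF⟩ := Metric.uniformContinuousOn_iff.1 hUC (ε / (2 * (C + 1))) (by positivity)
  have hFW : IsCompact (F '' W) := h.isCompact.image_of_continuousOn h.continuousOn
  have htail := Metric.tendstoUniformlyOn_iff.1
    (tendstoUniformlyOn_of_isCompact_of_opNorm_le hC hFW (fun w _ => h.tendsto_proj w))
    (ε / 2) (by positivity)
  have hclose := Metric.tendstoUniformlyOn_iff.1 (tendstoUniformlyOn_slice hφ hx) η hη
  filter_upwards [htail, hclose] with n hn hn' t ht
  have hφW : φ x t ∈ W := h.limit_mem hφ hx ht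
  have huW : u n x t ∈ W := h.sol_mem n x hx t ht
  have h1 : dist (F (φ x t)) (F (u n x t)) < ε / (2 * (C + 1)) := hηF _ hφW _ huW (hn' t ht)
  have h2 : dist (F (φ x t)) (P n (F (φ x t))) < ε / 2 := hn (F (φ x t)) ⟨φ x t, hφW, rfl⟩
  rw [dist_eq_norm] at h1 h2 ⊢
  have h3 : ‖P n (F (φ x t)) - P n (F (u n x t))‖ ≤ C * (ε / (2 * (C + 1))) := by
    rw [← map_sub]
    exact ((P n).le_opNorm _).trans (mul_le_mul (hC n) h1.le (norm_nonneg _) hC0)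
  have h4 : C * (ε / (2 * (C + 1))) ≤ ε / 2 := by
    rw [mul_div_assoc', div_le_div_iff₀ (by positivity) (by positivity)]
    nlinarith
  calc ‖F (φ x t) - P n (F (u n x t))‖
      = ‖(F (φ x t) - P n (F (φ x t))) + (P n (F (φ x t)) - P n (F (u n x t)))‖ := by
        congr 1; abel
    _ ≤ ‖F (φ x t) - P n (F (φ x t))‖ + ‖P n (F (φ x t)) - P n (F (u n x t))‖ := norm_add_le _ _
    _ < ε / 2 + ε / 2 := by linarith
    _ = ε := by ring

/-- EXISTENCE: the limit solves the full equation `φ' = F (φ)` on `(0, T)`.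
[cite: WilczakZgliczynski2025, Thm. 11 (2), proof ("Existence")] -/
theorem limit_hasDerivAt (h : GalerkinConvergenceSetting P F W Z T l u)
    (hφ : TendstoUniformlyOn (fun n (p : E × ℝ) => u n p.1 p.2) (fun p => φ p.1 p.2) atTop
      (Z ×ˢ Icc 0 T)) {x : E} (hx : x ∈ Z) {t : ℝ} (ht : t ∈ Ioo 0 T) :
    HasDerivAt (φ x) (F (φ x t)) t :=
  hasDerivAt_of_tendstoUniformlyOn isOpen_Ioo
    ((h.tendstoUniformlyOn_field hφ hx).mono Ioo_subset_Icc_self)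
    (Eventually.of_forall fun n s hs => h.sol_hasDerivAt n x hx s hs)
    (fun _ hs => (tendstoUniformlyOn_slice hφ hx).tendsto_at (Ioo_subset_Icc_self hs)) ht

/-- UNIQUENESS WITHIN `W`: every solution of `w' = F (w)` on `(0, T)`, continuous on `[0, T]`,
starting at `x ∈ Z` and staying in `W`, is the limit `φ x` (it is the uniform limit of the
Galerkin solutions). [cite: WilczakZgliczynski2025, Thm. 11 (2), proof ("Uniqueness")] -/
theorem limit_unique (h : GalerkinConvergenceSetting P F W Z T l u)
    (hφ : TendstoUniformlyOn (fun n (p : E × ℝ) => u n p.1 p.2) (fun p => φ p.1 p.2) atTop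
      (Z ×ˢ Icc 0 T)) {x : E} (hx : x ∈ Z) {w : ℝ → E} (hw : ContinuousOn w (Icc 0 T))
    (hw0 : w 0 = x) (hw' : ∀ t ∈ Ioo 0 T, HasDerivAt w (F (w t)) t)
    (hwW : ∀ t ∈ Icc 0 T, w t ∈ W) {t : ℝ} (ht : t ∈ Icc 0 T) : w t = φ x t := by
  -- the Galerkin solutions converge to `w t`
  have hconv : Tendsto (fun n => u n x t) atTop (𝓝 (w t)) := by
    rw [Metric.tendsto_atTop]
    intro ε hε
    set B := gronwallBound 0 l 1 T with hB
    have hB0 : 0 ≤ B := gronwallBound_zero_one_nonneg h.nonneg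
    obtain ⟨N₁, hN₁⟩ := eventually_atTop.1 (h.eventually_defect_le (ε := ε / (2 * (B + 1)))
      (by positivity))
    obtain ⟨N₂, hN₂⟩ := Metric.tendsto_atTop.1 (h.tendsto_proj (w t)) (ε / 2) (by positivity)
    refine ⟨max N₁ N₂, fun n hn => ?_⟩
    have hn₁ : N₁ ≤ n := (le_max_left _ _).trans hn
    have hn₂ : N₂ ≤ n := (le_max_right _ _).trans hn
    have key := dist_le_of_approx_trajectories_of_oneSidedLipschitz_of_hasDerivAt
      (v := fun _ y => P n (F y)) (s := fun _ => P n '' W) (l := l) (f := u n x)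
      (g := fun t => P n (w t)) (f' := fun t => P n (F (u n x t)))
      (g' := fun t => P n (F (w t))) (a := 0) (b := T) (εf := 0) (εg := ε / (2 * (B + 1)))
      (δ := 0)
      (fun _ _ => h.oneSided n) (h.sol_continuousOn n x hx)
      (fun t ht => h.sol_hasDerivAt n x hx t ht) (fun t _ => (dist_self _).le)
      (fun t ht => ⟨u n x t, h.sol_mem n x hx t (Ioo_subset_Icc_self ht),
        h.sol_proj n x hx t (Ioo_subset_Icc_self ht)⟩)
      ((P n).continuous.comp_continuousOn hw)
      (fun t ht => (P n).hasFDerivAt.comp_hasDerivAt t (hw' t ht))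
      (fun t ht => by
        rw [dist_eq_norm]
        exact hN₁ n hn₁ _ (hwW t (Ioo_subset_Icc_self ht)))
      (fun t ht => ⟨w t, hwW t (Ioo_subset_Icc_self ht), rfl⟩)
      (by rw [h.sol_init n x hx, hw0, dist_self])
      t ht
    rw [zero_add, sub_zero, gronwallBound_zero_eq_mul] at key
    have e1 : dist (u n x t) (P n (w t)) ≤ ε / (2 * (B + 1)) * B :=
      key.trans (mul_le_mul_of_nonneg_left (gronwallBound_zero_one_mono ht.2) (by positivity))
    have e2 : dist (P n (w t)) (w t) < ε / 2 := hN₂ n hn₂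
    have e3 : ε / (2 * (B + 1)) * B < ε / 2 := by
      rw [div_mul_eq_mul_div, div_lt_div_iff₀ (by positivity) (by positivity)]
      nlinarith
    calc dist (u n x t) (w t) ≤ dist (u n x t) (P n (w t)) + dist (P n (w t)) (w t) :=
          dist_triangle _ _ _
      _ < ε / 2 + ε / 2 := by linarith
      _ = ε := by ring
  exact tendsto_nhds_unique hconv ((tendstoUniformlyOn_slice hφ hx).tendsto_at ht)

/-- LIPSCHITZ CONSTANT `e^{l t}` of the limit semiflow on `Z`.
[cite: WilczakZgliczynski2025, Thm. 11 (3)] -/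
theorem limit_lipschitz (h : GalerkinConvergenceSetting P F W Z T l u)
    (hφ : TendstoUniformlyOn (fun n (p : E × ℝ) => u n p.1 p.2) (fun p => φ p.1 p.2) atTop
      (Z ×ˢ Icc 0 T)) {x y : E} (hx : x ∈ Z) (hy : y ∈ Z) {t : ℝ} (ht : t ∈ Icc 0 T) :
    ‖φ x t - φ y t‖ ≤ Real.exp (l * t) * ‖x - y‖ := by
  have h1 : Tendsto (fun n => ‖u n x t - u n y t‖) atTop (𝓝 ‖φ x t - φ y t‖) :=
    (((tendstoUniformlyOn_slice hφ hx).tendsto_at ht).sub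
      ((tendstoUniformlyOn_slice hφ hy).tendsto_at ht)).norm
  have h2 : Tendsto (fun n => Real.exp (l * t) * ‖P n x - P n y‖) atTop
      (𝓝 (Real.exp (l * t) * ‖x - y‖)) :=
    (((h.tendsto_proj x).sub (h.tendsto_proj y)).norm).const_mul _
  exact le_of_tendsto_of_tendsto' h1 h2 fun n => h.norm_sub_le_exp n hx hy ht

end Limit

/-- **`C⁰`-convergence of Galerkin flows** ([WilczakZgliczynski2025, Thm. 11 (1)–(3)], abstract
form).  In the setting `GalerkinConvergenceSetting P F W Z T l u` on a Banach space there is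
`φ : Z × [0, T] → W` such that: (1) the Galerkin solutions `u n` converge to `φ` uniformly on
`Z × [0, T]`; (2) for every `x ∈ Z`, `φ x` is continuous on `[0, T]`, starts at `x`, stays in
`W`, solves `φ' = F (φ)` on `(0, T)`, and every solution of `w' = F (w)` on `(0, T)` that is
continuous on `[0, T]`, starts at `x` and stays in `W` coincides with `φ x`; (3)
`‖φ x t - φ y t‖ ≤ e^{l t} ‖x - y‖`.
[cite: WilczakZgliczynski2025, §4 Thm. 11 (1)–(3)] -/
theorem exists_limit [CompleteSpace E] (h : GalerkinConvergenceSetting P F W Z T l u) :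
    ∃ φ : E → ℝ → E,
      TendstoUniformlyOn (fun n (p : E × ℝ) => u n p.1 p.2) (fun p => φ p.1 p.2) atTop
        (Z ×ˢ Icc 0 T) ∧
      (∀ x ∈ Z, φ x 0 = x ∧ ContinuousOn (φ x) (Icc 0 T) ∧ (∀ t ∈ Icc 0 T, φ x t ∈ W) ∧
        ∀ t ∈ Ioo 0 T, HasDerivAt (φ x) (F (φ x t)) t) ∧
      (∀ x ∈ Z, ∀ w : ℝ → E, ContinuousOn w (Icc 0 T) → w 0 = x →
        (∀ t ∈ Ioo 0 T, HasDerivAt w (F (w t)) t) → (∀ t ∈ Icc 0 T, w t ∈ W) →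
        ∀ t ∈ Icc 0 T, w t = φ x t) ∧
      (∀ x ∈ Z, ∀ y ∈ Z, ∀ t ∈ Icc 0 T, ‖φ x t - φ y t‖ ≤ Real.exp (l * t) * ‖x - y‖) := by
  obtain ⟨φ, hφ⟩ := h.exists_tendstoUniformlyOn
  exact ⟨φ, hφ,
    fun x hx => ⟨h.limit_init hφ hx, h.limit_continuousOn hφ hx,
      fun t ht => h.limit_mem hφ hx ht, fun t ht => h.limit_hasDerivAt hφ hx ht⟩,
    fun x hx w hw hw0 hw' hwW t ht => h.limit_unique hφ hx hw hw0 hw' hwW ht,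
    fun x hx y hy t ht => h.limit_lipschitz hφ hx hy ht⟩

end GalerkinConvergenceSetting

end

end Literature.Analysis.ODE
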